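import Literature.NumberTheory.Automorphic.HeckeFixedVectorsIntertwiners
import HarnessLib

/-!
# Semilinear form of the extension theorem: `ι`-semilinear Hecke-equivariant maps on `K`-fixed vectors extend to
# `ι`-semilinear intertwiners (reading a `k`-representation inside a `k′`-representation along `ι : k ≃ k′`)

Topic `NumberTheory/Automorphic`; namespace `Literature.NumberTheory.Automorphic`.  Sequel to `HeckeFixedVectorsIntertwiners`
(`exists_intertwiningMap_extending`: `k`-LINEAR Hecke-equivariant maps `W^K → V^K` extend to intertwiners, `W` irreducible, `V`
semisimple).  Here the source `(ρ, W)` is a representation over `k`, the target `(σ, V)` over `k′`, and the maps are `ι`-SEMILINEAR for a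
ring isomorphism `ι : k ≃+* k′` — the bookkeeping of «`ι_ℓ ∘ ω`» ([Liu2021] §4.2 l. 2162–2165: a complex representation `ω` read inside an
`ℓ`-adic one along `ι_ℓ : ℂ ≅ ℚ̄_ℓ`; the Hom-space `Hom_{ℚ̄_ℓ[G]}(ι_ℓ ∘ ω, V)` of the tree is a space of `ι`-semilinear maps,
`Sec42Data.EtaleHeckeDatum.omegaHom`).  THEOREMS ONLY: no definition, no named fact, no instance, no `sorry`.

Method: restriction of scalars along `ι` — inside the proof `V` is given the `k`-module structure `a • v := ι a • v`
(`Module.compHom`), under which `σ` is a `k`-representation with the SAME subrepresentations (so still semisimple), the same `K`-fixed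
vectors and the same Hecke operators, and an `ι`-semilinear map `W → V` is a `k`-linear map; then `exists_intertwiningMap_extending` applies.

* `exists_semilinear_intertwiner_extending` — `ι : k ≃+* k′`, `ρ` irreducible over `k`, `σ` semisimple over `k′`, all double cosets of `K`
  finite, `L : W →ₛₗ[ι] V` with `L(W^K) ⊆ V^K` and `L [KgK] = [KgK] L` on `W^K` ⇒ there is an `ι`-semilinear `f : W →ₛₗ[ι] V` with
  `f ∘ ρ(g) = σ(g) ∘ f` for all `g` and `f = L` on `W^K`.
* `semilinear_intertwiner_eq_of_eqOn_fixedPoints` — uniqueness: two `ι`-semilinear intertwiners agreeing on `W^K ≠ 0` are equal.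

Cell note (hodgecm-mathlib, crux `HLiu418` = stmt-HodgeConjecture-24832, d6 S2′ binder `hIsoSpan`): with `k = ℂ`, `k′ = ℚ̄_ℓ`, `ι = ι_ℓ`,
`V = ℚ̄_ℓ ⊗ H¹_ét(A_∞)` this is the form in which «every Hecke-equivariant image of `ω⋆^K` consists of values of elements of `omegaHom`» is
consumed; count-neutral; HC_CM is proved only modulo the 7 printed citations until rung 0 closes.

## References
* [Bump1997] D. Bump, *Automorphic Forms and Representations* (1997), Prop. 4.2.3 (p. 427).
* [BushnellHenniart2006] C. J. Bushnell, G. Henniart, *The Local Langlands Conjecture for GL(2)* (2006), §4.3 Proposition (2) (pp. 38–39).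
* [Liu2021] Y. Liu, *Fourier–Jacobi cycles and arithmetic relative trace formula*, Camb. J. Math. 9 (2021), §4.2 (FJcycle.tex l. 2162–2165).
-/

noncomputable section

open MulAction

namespace Literature.NumberTheory.Automorphic

section Semilinear

variable {k k' G V W : Type*} [Field k] [CharZero k] [Field k'] [Group G] [AddCommGroup V] [Module k' V]
  [AddCommGroup W] [Module k W] (ι : k ≃+* k') (ρ : Representation k G W) (σ : Representation k' G V) (K : Subgroup G)

/-- **Semilinear extension theorem** ([Bump1997] Prop. 4.2.3 (b) / [BushnellHenniart2006] §4.3 Proposition (2), read along a coefficient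
isomorphism `ι : k ≃ k′` as in [Liu2021] §4.2 «`ι_ℓ ∘ ω`»): for `ρ` irreducible over `k`, `σ` semisimple over `k′`, all double cosets
`KgK` finite and an `ι`-semilinear `L : W → V` mapping `W^K` into `V^K` and commuting there with the Hecke operators, some `ι`-semilinear
`G`-intertwiner `f : W → V` agrees with `L` on `W^K`.
[cite: Bump1997, Prop. 4.2.3] [cite: BushnellHenniart2006, §4.3 Proposition (2) (pp. 38–39)] [cite: Liu2021, §4.2 (FJcycle.tex l. 2162–2165)] -/
theorem exists_semilinear_intertwiner_extending [ρ.IsIrreducible] [σ.IsSemisimpleRepresentation]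
    (hfin : ∀ g : G, (orbit K (g : G ⧸ K)).Finite) (L : W →ₛₗ[(ι : k →+* k')] V)
    (hLK : ∀ w ∈ ρ.fixedPoints K, L w ∈ σ.fixedPoints K)
    (hL : ∀ g : G, ∀ w ∈ ρ.fixedPoints K, L (heckeOperator ρ K g w) = heckeOperator σ K g (L w)) :
    ∃ f : W →ₛₗ[(ι : k →+* k')] V, (∀ (g : G) (w : W), f (ρ g w) = σ g (f w)) ∧ ∀ w ∈ ρ.fixedPoints K, f w = L w := by
  classical
  -- restrict the scalars of `V` along `ι`
  letI mk : Module k V := Module.compHom V (ι : k →+* k')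
  have hsmul : ∀ (a : k) (v : V), (a • v : V) = (ι a : k') • v := fun _ _ => rfl
  -- `σ` as a `k`-representation
  let σk : Representation k G V :=
    { toFun := fun g =>
        { toFun := σ g
          map_add' := fun x y => map_add _ x y
          map_smul' := fun a v => by rw [hsmul, hsmul, map_smul]; rfl }
      map_one' := by ext v; simp
      map_mul' := fun g h => by ext v; simp }
  have hσk : ∀ (g : G) (v : V), σk g v = σ g v := fun _ _ => rfl
  -- same fixed vectors, same Hecke operators
  have hfix : ∀ v : V, v ∈ σk.fixedPoints K ↔ v ∈ σ.fixedPoints K := fun v => by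
    simp only [Representation.mem_fixedPoints, hσk]
  have hhecke : ∀ (g : G) (v : V), heckeOperator σk K g v = heckeOperator σ K g v := by
    intro g v
    rw [heckeOperator, heckeOperator, finsum_mem_eq_finite_toFinset_sum _ (hfin g), finsum_mem_eq_finite_toFinset_sum _ (hfin g),
      LinearMap.sum_apply, LinearMap.sum_apply]
    exact Finset.sum_congr rfl fun y _ => hσk _ _
  -- same subrepresentations, hence semisimple
  have hsub : ∀ (U : Subrepresentation σk), ∃ U' : Subrepresentation σ, (U'.toSubmodule : Set V) = U.toSubmodule := by
    intro U
    refine ⟨⟨{ carrier := (U.toSubmodule : Set V)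
               add_mem' := fun ha hb => U.toSubmodule.add_mem ha hb
               zero_mem' := U.toSubmodule.zero_mem
               smul_mem' := fun c v hv => ?_ }, fun g v hv => U.apply_mem_toSubmodule g hv⟩, rfl⟩
    change c • v ∈ U.toSubmodule
    have : (ι.symm c) • v ∈ U.toSubmodule := U.toSubmodule.smul_mem _ hv
    rwa [hsmul, RingEquiv.apply_symm_apply] at this
  have hsub' : ∀ (U' : Subrepresentation σ), ∃ U : Subrepresentation σk, (U.toSubmodule : Set V) = U'.toSubmodule := by
    intro U'
    refine ⟨⟨{ carrier := (U'.toSubmodule : Set V)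
               add_mem' := fun ha hb => U'.toSubmodule.add_mem ha hb
               zero_mem' := U'.toSubmodule.zero_mem
               smul_mem' := fun a v hv => ?_ }, fun g v hv => U'.apply_mem_toSubmodule g hv⟩, rfl⟩
    change a • v ∈ U'.toSubmodule
    rw [hsmul]
    exact U'.toSubmodule.smul_mem _ hv
  haveI : σk.IsSemisimpleRepresentation := by
    refine ⟨fun U => ?_⟩
    obtain ⟨U', hU'⟩ := hsub U
    obtain ⟨C', hC'⟩ := exists_isCompl U'
    obtain ⟨C, hC⟩ := hsub' C'
    refine ⟨C, ?_, ?_⟩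
    · rw [disjoint_iff]
      apply Subrepresentation.toSubmodule_injective
      apply SetLike.coe_injective
      rw [Subrepresentation.toSubmodule_inf, Submodule.coe_inf, ← hU', hC, ← Submodule.coe_inf, ← Subrepresentation.toSubmodule_inf,
        disjoint_iff.1 hC'.1]
      change ((⊥ : Submodule k' V) : Set V) = ((⊥ : Submodule k V) : Set V)
      simp
    · rw [codisjoint_iff]
      apply Subrepresentation.toSubmodule_injective
      rw [Subrepresentation.toSubmodule_sup]
      change U.toSubmodule ⊔ C.toSubmodule = (⊤ : Submodule k V)
      rw [eq_top_iff]
      intro v _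
      have hv : v ∈ (U' ⊔ C').toSubmodule := by
        rw [codisjoint_iff.1 hC'.2]
        change v ∈ (⊤ : Submodule k' V)
        exact Submodule.mem_top
      rw [Subrepresentation.toSubmodule_sup, Submodule.mem_sup] at hv
      obtain ⟨a, ha, b, hb, rfl⟩ := hv
      have ha' : a ∈ U.toSubmodule := by rw [← SetLike.mem_coe, ← hU']; exact ha
      have hb' : b ∈ C.toSubmodule := by rw [← SetLike.mem_coe, hC]; exact hb
      exact Submodule.add_mem_sup ha' hb'
  -- `L` as a `k`-linear map
  let Lk : W →ₗ[k] V :=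
    { toFun := L
      map_add' := fun x y => map_add L x y
      map_smul' := fun a w => by rw [hsmul, LinearMap.map_smulₛₗ]; rfl }
  have hLk : ∀ w, Lk w = L w := fun _ => rfl
  obtain ⟨f, hf⟩ := exists_intertwiningMap_extending ρ σk K hfin Lk
    (fun w hw => (hfix _).2 (hLK w hw)) (fun g w hw => by rw [hLk, hLk, hhecke]; exact hL g w hw)
  refine ⟨{ toFun := f, map_add' := fun x y => map_add f x y, map_smul' := fun a w => ?_ }, fun g w => ?_, fun w hw => ?_⟩
  · exact f.toLinearMap.map_smul a w
  · exact Representation.IntertwiningMap.isIntertwining ρ σk f g w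
  · exact hf w hw

omit [CharZero k] in
/-- **Uniqueness, semilinear form**: two `ι`-semilinear `G`-intertwiners out of an irreducible `W` with `W^K ≠ 0` that agree on `W^K`
are equal (`W` is the span of the `G`-translates of `W^K`). [cite: BushnellHenniart2006, §4.3 Proposition (2) (pp. 38–39)]
[cite: Bump1997, Prop. 4.2.3] -/
theorem semilinear_intertwiner_eq_of_eqOn_fixedPoints [ρ.IsIrreducible] (hne : ρ.fixedPoints K ≠ ⊥)
    (f f' : W →ₛₗ[(ι : k →+* k')] V) (hf : ∀ (g : G) (w : W), f (ρ g w) = σ g (f w))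
    (hf' : ∀ (g : G) (w : W), f' (ρ g w) = σ g (f' w)) (h : ∀ w ∈ ρ.fixedPoints K, f w = f' w) : f = f' := by
  apply LinearMap.ext
  intro w
  have hw : w ∈ Submodule.span k (⋃ g : G, ρ g '' (ρ.fixedPoints K : Set W)) := by
    rw [span_translates_fixedPoints_eq_top ρ K hne]
    exact Submodule.mem_top
  have hle : Submodule.span k (⋃ g : G, ρ g '' (ρ.fixedPoints K : Set W)) ≤ LinearMap.ker (f - f') := by
    refine Submodule.span_le.2 fun x hx => ?_
    obtain ⟨g, hxg⟩ := Set.mem_iUnion.1 hx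
    obtain ⟨v, hv, rfl⟩ := hxg
    change f (ρ g v) - f' (ρ g v) = 0
    rw [hf, hf', h v hv, sub_self]
  have := hle hw
  rw [LinearMap.mem_ker, LinearMap.sub_apply, sub_eq_zero] at this
  exact this

end Semilinear

end Literature.NumberTheory.Automorphic
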